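import Mathlib
import Summits.Parity.GeneralizedHardyLittlewood.Theses.LiouvilleMAD
import Summits.Parity.GeneralizedHardyLittlewood.Theorems.LiouvilleShiftedTablesMAvgOfLevel
import Summits.Parity.GeneralizedHardyLittlewood.Theorems.LiouvilleShiftedTablesPairsFromMAvg

/-!
# `LevelToPairs` (stmt-Parity-14550): `LambdaLiouvilleLevel → ElliottHalberstam → PairsHL`

Route `LiouvilleMAD` (Parity / GeneralizedHardyLittlewood), support item stmt-Parity-14550
(`LevelToPairs`, Murty–Vatwani in `λ`-form with `Λ`-weights: Bombieri–Vinogradov at level `N^{ε₀}`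
for `Λ(n) λ(n + h)` and the Elliott–Halberstam conjecture give Hardy–Littlewood pairs
`∑_{n ≤ N} Λ(n) Λ(n + h) = 𝔖({0, h}) N + o(N)` at every fixed shift `h ≥ 1`). The proof factors
through the sibling route `LiouvilleShiftedTables`: its item `PairsFromMAvg : EH → MAvg → PairsHL`
(Bombieri's level-1 asymptotic sieve for `a_n = Λ(n + h)`, PROVED in the tree:
`Summit.Parity.GeneralizedHardyLittlewood.Theorems.PairsFromMAvg_proof`) consumes exactly the parity
input `MAvg`
(`∑_{m ≤ x^ε} log m · |∑_{d ≤ x/m} μ(d) Λ(dm + h)| = o(x)`), and `MAvg` follows from the node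
`LambdaLiouvilleLevel` of this route (Bombieri–Vinogradov at level `N^{ε₀}` for `Λ(n) λ(n + h)`, one
residue and one height per modulus) by the tree's reduction
`MAvg_of_sum_abs_vonMangoldt_mul_liouville_progressions_le` (`μ = λ · ∑_{k² ∣ ·} μ(k)`, cut-off
`K = (log x)^4`, moduli `m k² ≤ x^{2ε}`): take the shift `-h`, the residue `w_q = h`, the height
`y_q = ⌊X⌋` at `N = ⌊X⌋ + 1`, `A = 6`, `ε = ε₀/2`.

* `sum_filter_Icc_eq_sum_filter_Ioc` — the terms `n ≤ h` of the level statement vanish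
  (`λ(toNat(n - h)) = λ(0) = 0`), and for `n > h` the integer shift is the natural one;
* `level_progressions_of_lambdaLiouvilleLevel` — the `≪ X/(log X)^6` progression form, real `X`;
* `MAvg_of_lambdaLiouvilleLevel` — `LambdaLiouvilleLevel → MAvg`;
* `levelToPairs_of_pairsFromMAvg` — `PairsFromMAvg → LevelToPairs` (`ElliottHalberstam` and the
  verbatim spelling `EH` are definitionally equal);
* `levelToPairs_proof` — the item, closed with the tree's `PairsFromMAvg_proof`.

[folklore; cite: Vatwani2016, §7.4]
-/

open Filter Asymptotics Finset

namespace Summit.Parity.GeneralizedHardyLittlewood.Theorems.LevelToPairs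

open ArithmeticFunction
open Summit.Parity.GeneralizedHardyLittlewood.Theses

/-- The inner sums of `LambdaLiouvilleLevel` at the shift `-h` and the residue `h`: the terms `n ≤ h`
vanish (`Int.toNat (n - h) = 0` and `λ 0 = 0`), and for `n > h` the shifted argument is `n - h`.
[folklore] -/
theorem sum_filter_Icc_eq_sum_filter_Ioc (h M q : ℕ) :
    ∑ n ∈ (Icc 1 M).filter (fun n : ℕ => n ≡ h [MOD q]),
        Λ n * (liouville (Int.toNat ((n : ℤ) + -(h : ℤ))) : ℝ)
      = ∑ n ∈ (Ioc h M).filter (fun n : ℕ => n ≡ h [MOD q]), Λ n * (liouville (n - h) : ℝ) := by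
  have hsub : (Ioc h M).filter (fun n : ℕ => n ≡ h [MOD q]) ⊆
      (Icc 1 M).filter (fun n : ℕ => n ≡ h [MOD q]) := by
    intro n hn
    simp only [mem_filter, mem_Ioc, mem_Icc] at hn ⊢
    exact ⟨⟨by omega, hn.1.2⟩, hn.2⟩
  rw [← Finset.sum_subset hsub]
  · refine Finset.sum_congr rfl fun n hn => ?_
    simp only [mem_filter, mem_Ioc] at hn
    have e : (n : ℤ) + -(h : ℤ) = ((n - h : ℕ) : ℤ) := by
      rw [Nat.cast_sub hn.1.1.le]; ring
    rw [e, Int.toNat_natCast]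
  · intro n hn hn'
    have hnh : n ≤ h := by
      by_contra hlt
      push Not at hlt
      apply hn'
      simp only [mem_filter, mem_Ioc, mem_Icc] at hn ⊢
      exact ⟨⟨hlt, hn.1.2⟩, hn.2⟩
    have e : Int.toNat ((n : ℤ) + -(h : ℤ)) = 0 := by
      rw [Int.toNat_eq_zero]; omega
    rw [e, ArithmeticFunction.map_zero, Int.cast_zero, mul_zero]

/-- **The progression form of `LambdaLiouvilleLevel`.** For `h ≥ 1`: with `ε = ε₀(-h)/2` and `A = 6`
there are `C`, `X₀` with `∑_{q ≤ X^{2ε}} |∑_{h < n ≤ X, n ≡ h (mod q)} Λ(n) λ(n - h)| ≤ C X/(log X)^6`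
for all real `X ≥ X₀` (apply the level statement at `N = ⌊X⌋ + 1` with the residue `h` and the height
`⌊X⌋` for every modulus; `⌊X^{ε₀}⌋ ≤ ⌊N^{ε₀}⌋`, `N ≤ 2X`, `log N ≥ log X`). [folklore] -/
theorem level_progressions_of_lambdaLiouvilleLevel (hL : LiouvilleMAD.LambdaLiouvilleLevel)
    {h : ℕ} (hh : 1 ≤ h) :
    ∃ ε : ℝ, 0 < ε ∧ ∃ A : ℝ, 5 < A ∧ ∃ C X₀ : ℝ, ∀ X : ℝ, X₀ ≤ X →
      ∑ q ∈ Icc 1 ⌊X ^ (2 * ε)⌋₊,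
          |∑ n ∈ (Ioc h ⌊X⌋₊).filter (fun n => n ≡ h [MOD q]), Λ n * (liouville (n - h) : ℝ)|
        ≤ C * X / Real.log X ^ A := by
  have hh0 : (-(h : ℤ)) ≠ 0 := by omega
  obtain ⟨ε₀, hε₀, hA⟩ := hL (-(h : ℤ)) hh0
  obtain ⟨C, N₀, hC⟩ := hA 6 (by norm_num)
  refine ⟨ε₀ / 2, by positivity, 6, by norm_num, 2 * max C 0, max (N₀ : ℝ) 2, fun X hX => ?_⟩
  have hXN₀ : (N₀ : ℝ) ≤ X := le_trans (le_max_left _ _) hX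
  have hX2 : (2 : ℝ) ≤ X := le_trans (le_max_right _ _) hX
  have hX0 : 0 ≤ X := by linarith
  set M := ⌊X⌋₊ with hM
  have hN₀ : N₀ ≤ M + 1 := by
    have : N₀ ≤ M := Nat.le_floor hXN₀
    omega
  have hXN : X ≤ ((M + 1 : ℕ) : ℝ) := by
    have := Nat.lt_floor_add_one X
    push_cast
    linarith
  have hN2X : ((M + 1 : ℕ) : ℝ) ≤ 2 * X := by
    have : (M : ℝ) ≤ X := Nat.floor_le hX0
    push_cast
    linarith
  have key := hC (M + 1) hN₀ (fun _ => h) (fun _ => M) (fun _ => Nat.le_succ M)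
  simp only [sum_filter_Icc_eq_sum_filter_Ioc] at key
  have h2ε : 2 * (ε₀ / 2) = ε₀ := by ring
  rw [h2ε]
  have hsub : Icc 1 ⌊X ^ ε₀⌋₊ ⊆ Icc 1 ⌊((M + 1 : ℕ) : ℝ) ^ ε₀⌋₊ :=
    Icc_subset_Icc_right (Nat.floor_le_floor (Real.rpow_le_rpow hX0 hXN hε₀.le))
  have hlogX : 0 < Real.log X := Real.log_pos (by linarith)
  have hlogN : Real.log X ≤ Real.log ((M + 1 : ℕ) : ℝ) := Real.log_le_log (by linarith) hXN
  have hC0 : 0 ≤ max C 0 := le_max_right _ _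
  calc ∑ q ∈ Icc 1 ⌊X ^ ε₀⌋₊,
        |∑ n ∈ (Ioc h M).filter (fun n => n ≡ h [MOD q]), Λ n * (liouville (n - h) : ℝ)|
      ≤ ∑ q ∈ Icc 1 ⌊((M + 1 : ℕ) : ℝ) ^ ε₀⌋₊,
          |∑ n ∈ (Ioc h M).filter (fun n => n ≡ h [MOD q]), Λ n * (liouville (n - h) : ℝ)| :=
        Finset.sum_le_sum_of_subset_of_nonneg hsub (fun _ _ _ => abs_nonneg _)
    _ ≤ C * ((M + 1 : ℕ) : ℝ) / Real.log ((M + 1 : ℕ) : ℝ) ^ (6 : ℝ) := key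
    _ ≤ max C 0 * ((M + 1 : ℕ) : ℝ) / Real.log ((M + 1 : ℕ) : ℝ) ^ (6 : ℝ) :=
        div_le_div_of_nonneg_right (mul_le_mul_of_nonneg_right (le_max_left C 0) (Nat.cast_nonneg _))
          (Real.rpow_nonneg (hlogX.le.trans hlogN) _)
    _ ≤ max C 0 * (2 * X) / Real.log X ^ (6 : ℝ) :=
        div_le_div₀ (by positivity) (mul_le_mul_of_nonneg_left hN2X hC0)
          (Real.rpow_pos_of_pos hlogX _) (Real.rpow_le_rpow hlogX.le hlogN (by norm_num))
    _ = 2 * max C 0 * X / Real.log X ^ (6 : ℝ) := by ring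

/-- **Step A of `LevelToPairs`: `LambdaLiouvilleLevel → MAvg`.** Bombieri–Vinogradov at level `N^{ε₀}`
for `Λ(n) λ(n + h)` (all shifts `h ≠ 0`, one residue and one height per modulus) implies Bombieri's
level-1 residual `MAvg` of route `LiouvilleShiftedTables`
(`∑_{m ≤ x^ε} log m · |∑_{d ≤ x/m} μ(d) Λ(dm + h)| = o(x)` with `ε = ε₀(-h)/2`), by the tree's
`MAvg_of_sum_abs_vonMangoldt_mul_liouville_progressions_le`. [cite: Vatwani2016, §7.4] -/
theorem MAvg_of_lambdaLiouvilleLevel (hL : LiouvilleMAD.LambdaLiouvilleLevel) :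
    LiouvilleShiftedTables.MAvg :=
  MAvg.MAvg_of_sum_abs_vonMangoldt_mul_liouville_progressions_le
    (fun _ hh => level_progressions_of_lambdaLiouvilleLevel hL hh)

/-- **`LevelToPairs` modulo `PairsFromMAvg`.** The item `LevelToPairs` of route `LiouvilleMAD`
(`LambdaLiouvilleLevel → ElliottHalberstam → PairsHL`) follows from the item `PairsFromMAvg` of route
`LiouvilleShiftedTables` (`EH → MAvg → PairsHL`, Bombieri's level-1 asymptotic sieve for `Λ(n + h)`
under Elliott–Halberstam): `ElliottHalberstam` (the Literature constant, by name) and the verbatim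
spelling `EH` agree definitionally, and `MAvg` is step A. [folklore] -/
theorem levelToPairs_of_pairsFromMAvg (hP : LiouvilleShiftedTables.PairsFromMAvg) :
    LiouvilleMAD.LevelToPairs :=
  fun hL hEH => hP hEH (MAvg_of_lambdaLiouvilleLevel hL)

end Summit.Parity.GeneralizedHardyLittlewood.Theorems.LevelToPairs

namespace Summit.Parity.GeneralizedHardyLittlewood.Theorems

/-- **`LevelToPairs`** (stmt-Parity-14550, route `LiouvilleMAD`): `LambdaLiouvilleLevel → ElliottHalberstam →`
Hardy–Littlewood pairs at every fixed shift, `∑_{n ≤ N} Λ(n) Λ(n + h) = 𝔖({0, h}) N + o(N)` (`h ≥ 1`)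
— Murty–Vatwani in `λ`-form with `Λ`-weights. Proof: Bombieri–Vinogradov at level `N^{ε₀}` for
`Λ(n) λ(n + h)` gives Bombieri's level-1 residual `MAvg` (`MAvg_of_lambdaLiouvilleLevel`), and
Bombieri's asymptotic sieve for `Λ(n + h)` under Elliott–Halberstam (`PairsFromMAvg_proof`, route
`LiouvilleShiftedTables`) gives the pairs asymptotic with the singular series `𝔖({0, h})`.
(Murty–Vatwani, J. Number Theory 180 (2017); Vatwani's thesis, Theorem 7.1.2 and §7.4.)
[cite: Vatwani2016, Theorem 7.1.2] -/
theorem levelToPairs_proof :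
    Summit.Parity.GeneralizedHardyLittlewood.Theses.LiouvilleMAD.LevelToPairs :=
  LevelToPairs.levelToPairs_of_pairsFromMAvg PairsFromMAvg_proof

end Summit.Parity.GeneralizedHardyLittlewood.Theorems
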